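import Literature.AlgebraicGeometry.Motives.HodgeStructureLefschetzGroupCenterPointsCount
import HarnessLib

/-!
# `S₀(A)(K)` WITH ITS ACTION ON `V ⊗ K`, FIRST KIND: A CENTRAL `γ ∈ S(A)(K)` IS AN INVOLUTION AND `V ⊗ K = V₊(γ) ⊕ V₋(γ)` WITH
# `V_±(γ)` STABLE UNDER `E_φ ⊗ K`, `C(A) ⊗ K` AND `S(A)(K)`, `Q_K`-ORTHOGONAL, AND `γ` IS DETERMINED BY `V₋(γ)` — for every field
# `K ⊇ ℚ` (Milne 1999 §1 p. 645 `S₀(A)(R)`, Prop. 1.7, Remark 1.6, §2 «with their actions on V(A)»; Moonen–Zarhin 1998 §1 Lemma (1))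

[topic AlgebraicGeometry/Motives]

Layer `Literature/AlgebraicGeometry/Motives`, lane `lit-hodgefound` (Track 2 foundations library; prover seat
`lit-hodgefound-p02`, generation 55, self-proposed row g55-#12). THEOREMS ONLY: no definition, no named fact (net debt `0`),
no instance, no notation.  «We wish to calculate `C(A)` and `S(A)`, together with their actions on `V(A)`» (Milne §2, p. 645):
for the CENTRE this is the action of `S₀(A)(K) = {γ ∈ C₀ ⊗ K | γ†γ = 1}` (p. 645, Prop. 1.7) on `V(A) ⊗ K`, uniformly in the
coefficient field (Remark 1.6).  For `†` OF THE FIRST KIND every central `γ ∈ S(H)(K)` is an involution (g54-#6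
`Polarization.coe_mul_coe_eq_one_of_mem_center_lefschetzGroupBaseChange`), and this file records its action on `K ⊗_ℚ V` — the
`K`-points companion of g55-#4 ∕ g55-#7 (which treat `K = ℚ` through the canonical blocks):
(i) `K ⊗ V = V₊(γ) ⊕ V₋(γ)`, `V_±(γ) = ker(γ ∓ 1)` (`char K = 0`);
(ii) `V_±(γ)` are stable under every `a_K`, `a ∈ E_φ` (they are `(E_φ ⊗ K)`-submodules), under every `c ∈ C(H)(K) = C(A) ⊗ K`
(`γ` is central in `C(H)(K)`, g54-#4) and under every `δ ∈ S(H)(K)`;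
(iii) `V₊(γ) ⊥ V₋(γ)` for `Q_K` (`γ` preserves `Q_K`), and `Q_K` restricted to each of `V_±(γ)` is non-degenerate;
(iv) a central `γ` is determined by `V₋(γ)`: `V₋(γ) = V₋(γ') ⟹ γ = γ'`; `V₋(γ) = 0 ⟺ γ = 1`, `V₊(γ) = 0 ⟺ γ = −1` on `K ⊗ V`.
Together with g55-#8 (`#Z(S(H)(K)) = 2^{t_K}`): the `2^{t_K}` central elements are the `2^{t_K}` sign choices on the `t_K` blocks
of `K ⊗ V` cut out by the primitive idempotents of `C₀ ⊗ K`.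

## The sources, verbatim

* J. S. Milne, *Lefschetz classes on abelian varieties*, Duke Math. J. 96 (1999) 639–675 [Milne1999LefschetzClasses] (held
  `paper:doi-10-1215-s0012-7094-99-09620-5`): folio 6 = p. 644 L16–L20 «`S(A)(R) = {γ ∈ C(A) ⊗_k R | γ†γ = 1}`. Thus, for any ample
  divisor `D` on `A`, `S(A)` is the largest algebraic subgroup of `Sp(e_D)` whose elements commute with the endomorphisms of `A`.»,
  Remark 1.6 «`C'(A) ≅ C(A) ⊗_k k'`, `S'(A) ≅ S(A)_{/k'}`»; folio 7 = p. 645 L1–L14 «`C₀(A)` … is a product of fields …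
  `S₀(A)(R) = {γ ∈ C₀(A) ⊗_ℚ R | γ†γ = 1}` … Proposition 1.7», §2 L1–L3 «We wish to calculate `C(A)` and `S(A)`, together with
  their actions on `V(A)`».
* B. J. J. Moonen, Yu. G. Zarhin, *Weil classes on abelian varieties*, J. reine angew. Math. 496 (1998) 83–92
  [MoonenZarhin1998WeilClasses] (held `paper:arxiv-alg-geom_9612017`, chunk p0002 L121–L127): «Lemma. (1) The center of
  `G_div(X)` is the group `U_{K_B}` …»
* H. Lange, *Abelian Varieties over the Complex Numbers* (2023) [Lange2023AbelianVarietiesComplex], §2.6.2 Lemma 2.6.4.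

Nearest tree results, BY NAME: g54-#6 `Polarization.coe_mul_coe_eq_one_of_mem_center_lefschetzGroupBaseChange`; g54-#4
`Polarization.mem_center_lefschetzGroupBaseChange_iff_mem_center_centralizer`; g55-#7
`Polarization.isCompl_eigenspace_one_neg_one_of_mul_self_eq_one` (`K = ℚ`), g55-#4 `Polarization.eq_of_eigenspace_neg_one_eq`
(`K = ℚ`); `Polarization.mem_lefschetzGroupBaseChange_iff` (Milne's definition of `S(A)(R)`).

## Dictionary and what is proved (namespace `Literature.AlgebraicGeometry.Motives.HodgeStructure`)

`S(H)(K) = ψ.lefschetzGroupBaseChange K`, `Q_K = ψ.form.baseChange K`, `a_K = a.baseChange K`, `V_ε(γ) = Module.End.eigenspace ↑γ ε`;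
"first kind" = `∀ z ∈ Z(E_φ), z† = z`.

* §1 INVOLUTIONS `γ ∈ S(H)(K)` (any type): **`Polarization.isCompl_eigenspace_one_neg_one_of_coe_mul_coe_eq_one`** (`K ⊗ V = V₊ ⊕ V₋`),
  **`Polarization.baseChange_apply_mem_eigenspace_of_mem_lefschetzGroupBaseChange`** (`a_K V_ε ⊆ V_ε`),
  **`Polarization.baseChange_form_eq_zero_of_mem_eigenspace_one_of_mem_eigenspace_neg_one`** (`V₊ ⊥ V₋`) and `…_neg_one_of_…_one`,
  **`Polarization.eq_zero_of_mem_eigenspace_one_of_forall_baseChange_form_eq_zero`** ∕ `…_neg_one_…` (`Q_K|V_±` non-degenerate).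
* §2 CENTRAL `γ`, FIRST KIND: **`Polarization.isCompl_eigenspace_one_neg_one_of_mem_center_lefschetzGroupBaseChange`**,
  **`Polarization.apply_mem_eigenspace_of_mem_center_lefschetzGroupBaseChange`** (`δ V_ε ⊆ V_ε` for `δ ∈ S(H)(K)`),
  **`Polarization.centralizer_apply_mem_eigenspace_of_mem_center_lefschetzGroupBaseChange`** (`c V_ε ⊆ V_ε` for `c ∈ C(H)(K)`).
* §3 **`Polarization.eq_of_eigenspace_neg_one_eq_of_mem_center_lefschetzGroupBaseChange`** (`γ` is determined by `V₋(γ)`),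
  **`Polarization.eigenspace_neg_one_eq_bot_iff_eq_one`**, **`Polarization.eigenspace_one_eq_bot_iff_forall_apply_eq_neg`**.
-/

noncomputable section

open scoped TensorProduct

namespace Literature.AlgebraicGeometry.Motives

namespace HodgeStructure

universe u uK

variable (K : Type uK) [Field K] [Algebra ℚ K] {V : Type u} [AddCommGroup V] [Module ℚ V] [Module.Finite ℚ V] {n : ℤ}
  {H : HodgeStructure V n}

/-! ## §0 Linear algebra: an involution of a `K`-space, `char K = 0` -/

omit [Module.Finite ℚ V] in
/-- `2 ≠ 0` in a field containing `ℚ`. [folklore] -/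
private theorem two_ne_zero₅₅₁₂ : (2 : K) ≠ 0 := by
  rw [← map_ofNat (algebraMap ℚ K) 2]
  exact (map_ne_zero _).2 two_ne_zero

omit [Module.Finite ℚ V] in
/-- In a `K`-space (`2 ≠ 0` in `K`), `x = -x ⟹ x = 0`. [folklore] -/
private theorem eq_zero_of_eq_neg₅₅₁₂ {M : Type*} [AddCommGroup M] [Module K M] {x : M} (h : x = -x) : x = 0 := by
  have h2 : (2 : K) • x = 0 := by rw [two_smul]; exact eq_neg_iff_add_eq_zero.1 h
  exact (smul_eq_zero.1 h2).resolve_left (two_ne_zero₅₅₁₂ K)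

omit [Module.Finite ℚ V] in
/-- **AN INVOLUTION SPLITS THE SPACE INTO ITS `±1`-EIGENSPACES** (`char K ≠ 2`): `x = ½(x + γx) + ½(x − γx)`, `V₊ ∩ V₋ = 0`. [folklore] -/
private theorem isCompl_eigenspace_of_mul_self_eq_one₅₅₁₂ {M : Type*} [AddCommGroup M] [Module K M] {γ : Module.End K M}
    (hγ : γ * γ = 1) : IsCompl (Module.End.eigenspace γ 1) (Module.End.eigenspace γ (-1)) := by
  have hsq : ∀ x, γ (γ x) = x := fun x => by rw [← Module.End.mul_apply, hγ, Module.End.one_apply]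
  refine ⟨Submodule.disjoint_def.2 fun x hx hx' => ?_, codisjoint_iff.2 (Submodule.eq_top_iff'.2 fun x => ?_)⟩
  · rw [Module.End.mem_eigenspace_iff, one_smul] at hx
    rw [Module.End.mem_eigenspace_iff, neg_one_smul, hx] at hx'
    exact eq_zero_of_eq_neg₅₅₁₂ K hx'
  · have hx : x = (2 : K)⁻¹ • (x + γ x) + (2 : K)⁻¹ • (x - γ x) := by
      rw [← smul_add, add_add_sub_cancel, ← two_smul K x, smul_smul, inv_mul_cancel₀ (two_ne_zero₅₅₁₂ K), one_smul]
    rw [hx]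
    refine Submodule.add_mem _ (Submodule.mem_sup_left (Submodule.smul_mem _ _ ?_))
      (Submodule.mem_sup_right (Submodule.smul_mem _ _ ?_))
    · rw [Module.End.mem_eigenspace_iff, one_smul, map_add, hsq, add_comm]
    · rw [Module.End.mem_eigenspace_iff, neg_one_smul, map_sub, hsq, neg_sub]

/-! ## §1 Involutions `γ ∈ S(H)(K)`: `K ⊗ V = V₊(γ) ⊕ V₋(γ)`, `(E_φ ⊗ K)`-stable, `Q_K`-orthogonal -/

omit [Module.Finite ℚ V] in
/-- **`K ⊗ V = V₊(γ) ⊕ V₋(γ)` FOR AN INVOLUTION `γ ∈ S(H)(K)`** (`γ² = 1` on `K ⊗ V`; central or not, any type).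
[cite: Milne1999LefschetzClasses, §1 p. 644 L16–L20, p. 645 L1–L14 and Remark 1.6] [cite: Lange2023AbelianVarietiesComplex, §2.6.2 Lemma 2.6.4] -/
theorem Polarization.isCompl_eigenspace_one_neg_one_of_coe_mul_coe_eq_one (ψ : Polarization H) {γ : ψ.lefschetzGroupBaseChange K}
    (hγ2 : ((γ : (K ⊗[ℚ] V) ≃ₗ[K] (K ⊗[ℚ] V)) : Module.End K (K ⊗[ℚ] V)) *
      ((γ : (K ⊗[ℚ] V) ≃ₗ[K] (K ⊗[ℚ] V)) : Module.End K (K ⊗[ℚ] V)) = 1) :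
    IsCompl (Module.End.eigenspace (((γ : (K ⊗[ℚ] V) ≃ₗ[K] (K ⊗[ℚ] V)) : Module.End K (K ⊗[ℚ] V))) 1)
      (Module.End.eigenspace (((γ : (K ⊗[ℚ] V) ≃ₗ[K] (K ⊗[ℚ] V)) : Module.End K (K ⊗[ℚ] V))) (-1)) :=
  isCompl_eigenspace_of_mul_self_eq_one₅₅₁₂ K hγ2

omit [Module.Finite ℚ V] in
/-- **THE EIGENSPACES OF `γ ∈ S(A)(K)` ARE `(E_φ ⊗ K)`-STABLE**: `a_K V_ε(γ) ⊆ V_ε(γ)` for every `a ∈ E_φ` and every `ε ∈ K`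
(«elements commute with the endomorphisms of `A`»). [cite: Milne1999LefschetzClasses, §1 p. 644 L16–L20 and Remark 1.6] -/
theorem Polarization.baseChange_apply_mem_eigenspace_of_mem_lefschetzGroupBaseChange (ψ : Polarization H)
    (γ : ψ.lefschetzGroupBaseChange K) (ε : K) (a : H.endAlg) {x : K ⊗[ℚ] V}
    (hx : x ∈ Module.End.eigenspace (((γ : (K ⊗[ℚ] V) ≃ₗ[K] (K ⊗[ℚ] V)) : Module.End K (K ⊗[ℚ] V))) ε) :
    (a : Module.End ℚ V).baseChange K x ∈
      Module.End.eigenspace (((γ : (K ⊗[ℚ] V) ≃ₗ[K] (K ⊗[ℚ] V)) : Module.End K (K ⊗[ℚ] V))) ε := by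
  rw [Module.End.mem_eigenspace_iff, LinearEquiv.coe_coe] at hx ⊢
  rw [← ((ψ.mem_lefschetzGroupBaseChange_iff _).1 γ.2).1 a x, hx, map_smul]

omit [Module.Finite ℚ V] in
/-- **`V₊(γ) ⊥ V₋(γ)` FOR `Q_K`**, for every involution `γ ∈ S(H)(K)` (indeed for every `γ ∈ S(H)(K)`): `Q_K(x, y) = Q_K(γx, γy)
= Q_K(x, −y)` («subgroup of `Sp(e_D)`»). [cite: Milne1999LefschetzClasses, §1 p. 644 L16–L20 and Remark 1.6] -/
theorem Polarization.baseChange_form_eq_zero_of_mem_eigenspace_one_of_mem_eigenspace_neg_one (ψ : Polarization H)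
    (γ : ψ.lefschetzGroupBaseChange K) {x y : K ⊗[ℚ] V}
    (hx : x ∈ Module.End.eigenspace (((γ : (K ⊗[ℚ] V) ≃ₗ[K] (K ⊗[ℚ] V)) : Module.End K (K ⊗[ℚ] V))) 1)
    (hy : y ∈ Module.End.eigenspace (((γ : (K ⊗[ℚ] V) ≃ₗ[K] (K ⊗[ℚ] V)) : Module.End K (K ⊗[ℚ] V))) (-1)) :
    ψ.form.baseChange K x y = 0 := by
  rw [Module.End.mem_eigenspace_iff, LinearEquiv.coe_coe, one_smul] at hx
  rw [Module.End.mem_eigenspace_iff, LinearEquiv.coe_coe, neg_one_smul] at hy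
  have h := ((ψ.mem_lefschetzGroupBaseChange_iff _).1 γ.2).2 x y
  rw [hx, hy, map_neg] at h
  exact eq_zero_of_eq_neg₅₅₁₂ K h.symm

omit [Module.Finite ℚ V] in
/-- The same with the roles exchanged: `Q_K(x, y) = 0` for `x ∈ V₋(γ)`, `y ∈ V₊(γ)`. [cite: Milne1999LefschetzClasses, §1 p. 644 L16–L20 and Remark 1.6] -/
theorem Polarization.baseChange_form_eq_zero_of_mem_eigenspace_neg_one_of_mem_eigenspace_one (ψ : Polarization H)
    (γ : ψ.lefschetzGroupBaseChange K) {x y : K ⊗[ℚ] V}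
    (hx : x ∈ Module.End.eigenspace (((γ : (K ⊗[ℚ] V) ≃ₗ[K] (K ⊗[ℚ] V)) : Module.End K (K ⊗[ℚ] V))) (-1))
    (hy : y ∈ Module.End.eigenspace (((γ : (K ⊗[ℚ] V) ≃ₗ[K] (K ⊗[ℚ] V)) : Module.End K (K ⊗[ℚ] V))) 1) :
    ψ.form.baseChange K x y = 0 := by
  rw [Module.End.mem_eigenspace_iff, LinearEquiv.coe_coe, neg_one_smul] at hx
  rw [Module.End.mem_eigenspace_iff, LinearEquiv.coe_coe, one_smul] at hy
  have h := ((ψ.mem_lefschetzGroupBaseChange_iff _).1 γ.2).2 x y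
  rw [hx, hy, LinearMap.map_neg₂] at h
  exact eq_zero_of_eq_neg₅₅₁₂ K h.symm

/-- **`Q_K` RESTRICTED TO `V₊(γ)` IS NON-DEGENERATE** for an involution `γ ∈ S(H)(K)`: `V₊ ⊥ V₋`, `K ⊗ V = V₊ ⊕ V₋` and `Q_K` is
non-degenerate (the tree's `Polarization.baseChange_form_nondegenerate`) — each eigenblock is again "polarized".
[cite: Milne1999LefschetzClasses, §1 p. 644 L16–L20, proof of Prop. 1.3 (p. 643) and Remark 1.6] -/
theorem Polarization.eq_zero_of_mem_eigenspace_one_of_forall_baseChange_form_eq_zero (ψ : Polarization H)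
    {γ : ψ.lefschetzGroupBaseChange K}
    (hγ2 : ((γ : (K ⊗[ℚ] V) ≃ₗ[K] (K ⊗[ℚ] V)) : Module.End K (K ⊗[ℚ] V)) *
      ((γ : (K ⊗[ℚ] V) ≃ₗ[K] (K ⊗[ℚ] V)) : Module.End K (K ⊗[ℚ] V)) = 1)
    {x : K ⊗[ℚ] V} (hx : x ∈ Module.End.eigenspace (((γ : (K ⊗[ℚ] V) ≃ₗ[K] (K ⊗[ℚ] V)) : Module.End K (K ⊗[ℚ] V))) 1)
    (h : ∀ y ∈ Module.End.eigenspace (((γ : (K ⊗[ℚ] V) ≃ₗ[K] (K ⊗[ℚ] V)) : Module.End K (K ⊗[ℚ] V))) 1,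
      ψ.form.baseChange K x y = 0) :
    x = 0 := by
  have hc := ψ.isCompl_eigenspace_one_neg_one_of_coe_mul_coe_eq_one K hγ2
  refine (ψ.baseChange_form_nondegenerate K).1 x fun y => ?_
  obtain ⟨y₁, hy₁, y₂, hy₂, rfl⟩ := Submodule.mem_sup.1 (hc.sup_eq_top.symm ▸ Submodule.mem_top (x := y) :
    y ∈ Module.End.eigenspace (((γ : (K ⊗[ℚ] V) ≃ₗ[K] (K ⊗[ℚ] V)) : Module.End K (K ⊗[ℚ] V))) 1 ⊔
      Module.End.eigenspace (((γ : (K ⊗[ℚ] V) ≃ₗ[K] (K ⊗[ℚ] V)) : Module.End K (K ⊗[ℚ] V))) (-1))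
  rw [map_add, h y₁ hy₁, ψ.baseChange_form_eq_zero_of_mem_eigenspace_one_of_mem_eigenspace_neg_one K γ hx hy₂, add_zero]

/-- **`Q_K` RESTRICTED TO `V₋(γ)` IS NON-DEGENERATE** for an involution `γ ∈ S(H)(K)`.
[cite: Milne1999LefschetzClasses, §1 p. 644 L16–L20, proof of Prop. 1.3 (p. 643) and Remark 1.6] -/
theorem Polarization.eq_zero_of_mem_eigenspace_neg_one_of_forall_baseChange_form_eq_zero (ψ : Polarization H)
    {γ : ψ.lefschetzGroupBaseChange K}
    (hγ2 : ((γ : (K ⊗[ℚ] V) ≃ₗ[K] (K ⊗[ℚ] V)) : Module.End K (K ⊗[ℚ] V)) *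
      ((γ : (K ⊗[ℚ] V) ≃ₗ[K] (K ⊗[ℚ] V)) : Module.End K (K ⊗[ℚ] V)) = 1)
    {x : K ⊗[ℚ] V} (hx : x ∈ Module.End.eigenspace (((γ : (K ⊗[ℚ] V) ≃ₗ[K] (K ⊗[ℚ] V)) : Module.End K (K ⊗[ℚ] V))) (-1))
    (h : ∀ y ∈ Module.End.eigenspace (((γ : (K ⊗[ℚ] V) ≃ₗ[K] (K ⊗[ℚ] V)) : Module.End K (K ⊗[ℚ] V))) (-1),
      ψ.form.baseChange K x y = 0) :
    x = 0 := by
  have hc := ψ.isCompl_eigenspace_one_neg_one_of_coe_mul_coe_eq_one K hγ2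
  refine (ψ.baseChange_form_nondegenerate K).1 x fun y => ?_
  obtain ⟨y₁, hy₁, y₂, hy₂, rfl⟩ := Submodule.mem_sup.1 (hc.sup_eq_top.symm ▸ Submodule.mem_top (x := y) :
    y ∈ Module.End.eigenspace (((γ : (K ⊗[ℚ] V) ≃ₗ[K] (K ⊗[ℚ] V)) : Module.End K (K ⊗[ℚ] V))) 1 ⊔
      Module.End.eigenspace (((γ : (K ⊗[ℚ] V) ≃ₗ[K] (K ⊗[ℚ] V)) : Module.End K (K ⊗[ℚ] V))) (-1))
  rw [map_add, h y₂ hy₂, ψ.baseChange_form_eq_zero_of_mem_eigenspace_neg_one_of_mem_eigenspace_one K γ hx hy₁, zero_add]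

/-! ## §2 Central `γ ∈ S(H)(K)`, first kind: the decomposition is `C(H)(K)`- and `S(H)(K)`-stable -/

/-- **FIRST KIND, `γ` CENTRAL IN `S(A)(K)`: `K ⊗ V = V₊(γ) ⊕ V₋(γ)`** — central elements are involutions (g54-#6).
[cite: Milne1999LefschetzClasses, §1 p. 645 L1–L14 (S₀, Prop. 1.7) and Remark 1.6] [cite: MoonenZarhin1998WeilClasses, §1 Lemma (1)] -/
theorem Polarization.isCompl_eigenspace_one_neg_one_of_mem_center_lefschetzGroupBaseChange (ψ : Polarization H)
    (hfix : ∀ z : H.endAlg, z ∈ Subalgebra.center ℚ H.endAlg → ψ.adjoint (z : Module.End ℚ V) = z)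
    {γ : ψ.lefschetzGroupBaseChange K} (hγ : γ ∈ Subgroup.center (ψ.lefschetzGroupBaseChange K)) :
    IsCompl (Module.End.eigenspace (((γ : (K ⊗[ℚ] V) ≃ₗ[K] (K ⊗[ℚ] V)) : Module.End K (K ⊗[ℚ] V))) 1)
      (Module.End.eigenspace (((γ : (K ⊗[ℚ] V) ≃ₗ[K] (K ⊗[ℚ] V)) : Module.End K (K ⊗[ℚ] V))) (-1)) :=
  ψ.isCompl_eigenspace_one_neg_one_of_coe_mul_coe_eq_one K
    (ψ.coe_mul_coe_eq_one_of_mem_center_lefschetzGroupBaseChange K hfix hγ)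

omit [Module.Finite ℚ V] in
/-- **THE EIGENSPACES OF A CENTRAL `γ` ARE `S(A)(K)`-STABLE**: `δ V_ε(γ) ⊆ V_ε(γ)` for every `δ ∈ S(H)(K)` (any type; `δγ = γδ`).
[cite: Milne1999LefschetzClasses, §1 p. 644 L16–L20 and p. 645 L1–L14] -/
theorem Polarization.apply_mem_eigenspace_of_mem_center_lefschetzGroupBaseChange (ψ : Polarization H)
    {γ : ψ.lefschetzGroupBaseChange K} (hγ : γ ∈ Subgroup.center (ψ.lefschetzGroupBaseChange K))
    (δ : ψ.lefschetzGroupBaseChange K) (ε : K) {x : K ⊗[ℚ] V}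
    (hx : x ∈ Module.End.eigenspace (((γ : (K ⊗[ℚ] V) ≃ₗ[K] (K ⊗[ℚ] V)) : Module.End K (K ⊗[ℚ] V))) ε) :
    (δ : (K ⊗[ℚ] V) ≃ₗ[K] (K ⊗[ℚ] V)) x ∈
      Module.End.eigenspace (((γ : (K ⊗[ℚ] V) ≃ₗ[K] (K ⊗[ℚ] V)) : Module.End K (K ⊗[ℚ] V))) ε := by
  rw [Module.End.mem_eigenspace_iff, LinearEquiv.coe_coe] at hx ⊢
  have h := congrArg (fun g : ψ.lefschetzGroupBaseChange K => (g : (K ⊗[ℚ] V) ≃ₗ[K] (K ⊗[ℚ] V)) x)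
    (Subgroup.mem_center_iff.1 hγ δ)
  simp only [Subgroup.coe_mul, LinearEquiv.mul_apply] at h
  rw [← h, hx, map_smul]

/-- **THE EIGENSPACES OF A CENTRAL `γ` ARE `(C(A) ⊗ K)`-STABLE**: `c V_ε(γ) ⊆ V_ε(γ)` for every `c ∈ C(H)(K)` — a central `γ` lies
in the centre of `C(H)(K)` (g54-#4 `Z(S(H)(K)) = S(H)(K) ∩ Z(C(H)(K))`). [cite: Milne1999LefschetzClasses, §1 p. 644 L16–L24 and p. 645 L1–L14] -/
theorem Polarization.centralizer_apply_mem_eigenspace_of_mem_center_lefschetzGroupBaseChange (ψ : Polarization H)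
    {γ : ψ.lefschetzGroupBaseChange K} (hγ : γ ∈ Subgroup.center (ψ.lefschetzGroupBaseChange K))
    (c : Subalgebra.centralizer K ((fun a : Module.End ℚ V => a.baseChange K) '' (H.endAlg : Set (Module.End ℚ V)))) (ε : K)
    {x : K ⊗[ℚ] V} (hx : x ∈ Module.End.eigenspace (((γ : (K ⊗[ℚ] V) ≃ₗ[K] (K ⊗[ℚ] V)) : Module.End K (K ⊗[ℚ] V))) ε) :
    (c : Module.End K (K ⊗[ℚ] V)) x ∈
      Module.End.eigenspace (((γ : (K ⊗[ℚ] V) ≃ₗ[K] (K ⊗[ℚ] V)) : Module.End K (K ⊗[ℚ] V))) ε := by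
  rw [Module.End.mem_eigenspace_iff] at hx ⊢
  have hz := (ψ.mem_center_lefschetzGroupBaseChange_iff_mem_center_centralizer K γ).1 hγ
  have h := congrArg (fun z : Subalgebra.centralizer K ((fun a : Module.End ℚ V => a.baseChange K) ''
      (H.endAlg : Set (Module.End ℚ V))) => (z : Module.End K (K ⊗[ℚ] V)) x) (Subalgebra.mem_center_iff.1 hz c)
  simp only [Subalgebra.coe_mul, Module.End.mul_apply] at h
  rw [← h, hx, map_smul]

/-! ## §3 A central `γ` is determined by `V₋(γ)` -/

/-- **FIRST KIND: A CENTRAL `γ ∈ S(A)(K)` IS DETERMINED BY ITS `−1`-EIGENSPACE** — `V₋(γ) = V₋(γ') ⟹ γ = γ'` (`γ, γ'` commute, so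
`γ'` preserves `V₊(γ)`, on which it is an involution with `−1`-eigenspace `V₊(γ) ∩ V₋(γ) = 0`, i.e. the identity).  The `2^{t_K}`
central elements (g55-#8) are `2^{t_K}` distinct sign patterns on `K ⊗ V`. [cite: Milne1999LefschetzClasses, §1 p. 645 L1–L14 (S₀, Prop. 1.7) and Remark 1.6]
[cite: MoonenZarhin1998WeilClasses, §1 Lemma (1)] -/
theorem Polarization.eq_of_eigenspace_neg_one_eq_of_mem_center_lefschetzGroupBaseChange (ψ : Polarization H)
    (hfix : ∀ z : H.endAlg, z ∈ Subalgebra.center ℚ H.endAlg → ψ.adjoint (z : Module.End ℚ V) = z)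
    {γ γ' : ψ.lefschetzGroupBaseChange K} (hγ : γ ∈ Subgroup.center (ψ.lefschetzGroupBaseChange K))
    (hγ' : γ' ∈ Subgroup.center (ψ.lefschetzGroupBaseChange K))
    (h : Module.End.eigenspace (((γ : (K ⊗[ℚ] V) ≃ₗ[K] (K ⊗[ℚ] V)) : Module.End K (K ⊗[ℚ] V))) (-1) =
      Module.End.eigenspace (((γ' : (K ⊗[ℚ] V) ≃ₗ[K] (K ⊗[ℚ] V)) : Module.End K (K ⊗[ℚ] V))) (-1)) :
    γ = γ' := by
  have hc := ψ.isCompl_eigenspace_one_neg_one_of_mem_center_lefschetzGroupBaseChange K hfix hγ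
  have hsq' : ∀ x, (γ' : (K ⊗[ℚ] V) ≃ₗ[K] (K ⊗[ℚ] V)) ((γ' : (K ⊗[ℚ] V) ≃ₗ[K] (K ⊗[ℚ] V)) x) = x := fun x => by
    have h2 := congrArg (fun f : Module.End K (K ⊗[ℚ] V) => f x)
      (ψ.coe_mul_coe_eq_one_of_mem_center_lefschetzGroupBaseChange K hfix hγ')
    simpa only [Module.End.mul_apply, Module.End.one_apply, LinearEquiv.coe_coe] using h2
  -- on `V₊(γ)`: `γ' = id`
  have hplus : ∀ x ∈ Module.End.eigenspace (((γ : (K ⊗[ℚ] V) ≃ₗ[K] (K ⊗[ℚ] V)) : Module.End K (K ⊗[ℚ] V))) 1,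
      (γ' : (K ⊗[ℚ] V) ≃ₗ[K] (K ⊗[ℚ] V)) x = x := by
    intro x hx
    have hw1 : (γ' : (K ⊗[ℚ] V) ≃ₗ[K] (K ⊗[ℚ] V)) x - x ∈
        Module.End.eigenspace (((γ : (K ⊗[ℚ] V) ≃ₗ[K] (K ⊗[ℚ] V)) : Module.End K (K ⊗[ℚ] V))) 1 :=
      Submodule.sub_mem _ (ψ.apply_mem_eigenspace_of_mem_center_lefschetzGroupBaseChange K hγ γ' 1 hx) hx
    have hw2 : (γ' : (K ⊗[ℚ] V) ≃ₗ[K] (K ⊗[ℚ] V)) x - x ∈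
        Module.End.eigenspace (((γ : (K ⊗[ℚ] V) ≃ₗ[K] (K ⊗[ℚ] V)) : Module.End K (K ⊗[ℚ] V))) (-1) := by
      rw [h, Module.End.mem_eigenspace_iff, LinearEquiv.coe_coe, map_sub, hsq', neg_one_smul, neg_sub]
    have h0 : (γ' : (K ⊗[ℚ] V) ≃ₗ[K] (K ⊗[ℚ] V)) x - x = 0 := by
      rw [← Submodule.mem_bot K, ← hc.inf_eq_bot]
      exact ⟨hw1, hw2⟩
    exact sub_eq_zero.1 h0
  refine Subtype.ext (LinearEquiv.ext fun x => ?_)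
  obtain ⟨x₁, hx₁, x₂, hx₂, rfl⟩ := Submodule.mem_sup.1 (hc.sup_eq_top.symm ▸ Submodule.mem_top (x := x) :
    x ∈ Module.End.eigenspace (((γ : (K ⊗[ℚ] V) ≃ₗ[K] (K ⊗[ℚ] V)) : Module.End K (K ⊗[ℚ] V))) 1 ⊔
      Module.End.eigenspace (((γ : (K ⊗[ℚ] V) ≃ₗ[K] (K ⊗[ℚ] V)) : Module.End K (K ⊗[ℚ] V))) (-1))
  have hx₂' := h ▸ hx₂
  rw [Module.End.mem_eigenspace_iff, LinearEquiv.coe_coe] at hx₁ hx₂ hx₂'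
  rw [map_add, map_add, hx₁, hx₂, one_smul, hplus x₁ (by rw [Module.End.mem_eigenspace_iff, LinearEquiv.coe_coe, hx₁]), hx₂']

/-- **`V₋(γ) = 0` IFF `γ = 1`**, for a central `γ` of the first kind. [cite: Milne1999LefschetzClasses, §1 p. 645 L1–L14 and Remark 1.6] -/
theorem Polarization.eigenspace_neg_one_eq_bot_iff_eq_one (ψ : Polarization H)
    (hfix : ∀ z : H.endAlg, z ∈ Subalgebra.center ℚ H.endAlg → ψ.adjoint (z : Module.End ℚ V) = z)
    {γ : ψ.lefschetzGroupBaseChange K} (hγ : γ ∈ Subgroup.center (ψ.lefschetzGroupBaseChange K)) :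
    Module.End.eigenspace (((γ : (K ⊗[ℚ] V) ≃ₗ[K] (K ⊗[ℚ] V)) : Module.End K (K ⊗[ℚ] V))) (-1) = ⊥ ↔ γ = 1 := by
  have hone : Module.End.eigenspace ((((1 : ψ.lefschetzGroupBaseChange K) : (K ⊗[ℚ] V) ≃ₗ[K] (K ⊗[ℚ] V)) :
      Module.End K (K ⊗[ℚ] V))) (-1) = ⊥ := by
    refine (Submodule.eq_bot_iff _).2 fun x hx => ?_
    rw [Module.End.mem_eigenspace_iff, LinearEquiv.coe_coe, Subgroup.coe_one, LinearEquiv.coe_one, id_eq, neg_one_smul] at hx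
    exact eq_zero_of_eq_neg₅₅₁₂ K hx
  refine ⟨fun h => ?_, fun h => by rw [h]; exact hone⟩
  exact ψ.eq_of_eigenspace_neg_one_eq_of_mem_center_lefschetzGroupBaseChange K hfix hγ (Subgroup.one_mem _) (h.trans hone.symm)

omit [Module.Finite ℚ V] in
/-- **`V₊(γ) = 0` IFF `γ = −1` ON `K ⊗ V`**, for an involution `γ ∈ S(H)(K)`. [cite: Milne1999LefschetzClasses, §1 p. 645 L1–L14 and Remark 1.6] -/
theorem Polarization.eigenspace_one_eq_bot_iff_forall_apply_eq_neg (ψ : Polarization H) {γ : ψ.lefschetzGroupBaseChange K}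
    (hγ2 : ((γ : (K ⊗[ℚ] V) ≃ₗ[K] (K ⊗[ℚ] V)) : Module.End K (K ⊗[ℚ] V)) *
      ((γ : (K ⊗[ℚ] V) ≃ₗ[K] (K ⊗[ℚ] V)) : Module.End K (K ⊗[ℚ] V)) = 1) :
    Module.End.eigenspace (((γ : (K ⊗[ℚ] V) ≃ₗ[K] (K ⊗[ℚ] V)) : Module.End K (K ⊗[ℚ] V))) 1 = ⊥ ↔
      ∀ x, (γ : (K ⊗[ℚ] V) ≃ₗ[K] (K ⊗[ℚ] V)) x = -x := by
  have hc := isCompl_eigenspace_of_mul_self_eq_one₅₅₁₂ K hγ2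
  constructor
  · intro h x
    have hx : x ∈ Module.End.eigenspace (((γ : (K ⊗[ℚ] V) ≃ₗ[K] (K ⊗[ℚ] V)) : Module.End K (K ⊗[ℚ] V))) (-1) := by
      have htop := hc.sup_eq_top
      rw [h, bot_sup_eq] at htop
      rw [htop]
      exact Submodule.mem_top
    rw [Module.End.mem_eigenspace_iff, LinearEquiv.coe_coe, neg_one_smul] at hx
    exact hx
  · intro h
    refine (Submodule.eq_bot_iff _).2 fun x hx => ?_
    rw [Module.End.mem_eigenspace_iff, LinearEquiv.coe_coe, one_smul, h] at hx
    exact eq_zero_of_eq_neg₅₅₁₂ K hx.symm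

end HodgeStructure

end Literature.AlgebraicGeometry.Motives
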